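/-
Port part A (cell rh-split, LINE L4 «σ», D′ of RULING #290): jen-neg g15 `JensenSignLawCount.lean` sha16 ab2c5cde8b4fedb8,
source ll.45–204 verbatim (definitions `SignLaw`, `RolleExtremal` and Inputs 1–3); split only because Theorems files with
proofs are ≤ 400 lines.  Nothing here bears on the truth of RH.
-/
import Mathlib
import Literature.NumberTheory.LFunctions.RiemannXi
import Literature.NumberTheory.LFunctions.XiMoments
import Literature.Analysis.Complex.JensenLaguerreFlow
import Literature.Analysis.Complex.HutchinsonMultiplier
import Literature.Analysis.Complex.JensenPolynomialHyperbolicity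
import Summits.RiemannHypothesis.RiemannHypothesis.Theorems.Splittings.JointPoly
import Summits.RiemannHypothesis.RiemannHypothesis.Theorems.Splittings.JensenDerivativeLaguerre
import Summits.RiemannHypothesis.RiemannHypothesis.Theorems.Splittings.JensenCountMonotonicity
import HarnessLib

/-!
# SIGN LAW = ROLLE-EXTREMALITY, part A: the two predicates and the three analytic inputs (RH-free real-polynomial analysis)

HONEST LABEL: «SPLITTING SEARCH over kernel-typed RH-EQUIVALENCES; a splitting A ∧ B ⟹ RH is CONDITIONAL
bookkeeping unless A and B are both proved; nothing here bears on the truth of RH.»  This part is class-level, RH-free: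
`SignLaw p` (strict Laguerre sign law at the critical points off the zero set), `RolleExtremal p` (equality in
`Polynomial.card_roots_le_derivative`), Input 1 `exists_root_of_odd_natDegree`, Input 2 `exists_ball_lt_of_deriv2_pos`
(first-order strict local minimum), Input 3 `card_succ_le_of_localMin` (the enlarged interleaving).  The theorem
`signLaw_iff_rolleExtremal`, the ledger item `item22168` (stmt-RiemannHypothesis-22168) and the X-4 dictionary are in
`JensenSignLawCount.lean` (part B).  Source: desk file HOME/rh-split-jen-neg/g15/SigmaCount.lean e7f4e834b001ac7b.
-/

open Polynomial Set Filter Topology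

set_option linter.dupNamespace false

namespace Summit.RiemannHypothesis.RiemannHypothesis.Theorems.Splittings.JensenSignLawCount

open Summit.RiemannHypothesis.RiemannHypothesis.Theorems.Splittings.JointPoly

/-- The strict Laguerre sign law of a real polynomial at its critical points off the zero set. -/
def SignLaw (p : ℝ[X]) : Prop :=
  ∀ x : ℝ, (derivative p).eval x = 0 → p.eval x ≠ 0 → p.eval x * (derivative (derivative p)).eval x < 0

/-- «Rolle-extremal»: equality in `Polynomial.card_roots_le_derivative`. -/
def RolleExtremal (p : ℝ[X]) : Prop :=
  Multiset.card p.roots = Multiset.card (derivative p).roots + 1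

/-! ### Input 1: a real polynomial of odd degree has a real root -/

/-- A real polynomial of odd degree has a real root. [folklore] -/
theorem exists_root_of_odd_natDegree {p : ℝ[X]} (hodd : Odd p.natDegree) : ∃ x : ℝ, p.eval x = 0 := by
  wlog hlc : 0 < p.leadingCoeff generalizing p
  · have hp0 : p ≠ 0 := by
      rintro rfl
      simp at hodd
    have hne : p.leadingCoeff ≠ 0 := leadingCoeff_ne_zero.2 hp0
    have hlc' : 0 < (-p).leadingCoeff := by
      rw [leadingCoeff_neg]
      push Not at hlc
      exact neg_pos.2 (lt_of_le_of_ne hlc hne)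
    obtain ⟨x, hx⟩ := this (by rwa [natDegree_neg]) hlc'
    exact ⟨x, by simpa using hx⟩
  have hpos : 0 < p.natDegree := hodd.pos
  have hdeg : 0 < p.degree := natDegree_pos_iff_degree_pos.1 hpos
  have htop : Tendsto (fun x ↦ p.eval x) atTop atTop := p.tendsto_atTop_of_leadingCoeff_nonneg hdeg hlc.le
  set q : ℝ[X] := p.comp (-X) with hq
  have hqe : ∀ x, q.eval x = p.eval (-x) := fun x ↦ by simp [hq]
  have hnd : q.natDegree = p.natDegree := by
    rw [hq, natDegree_comp]; simp
  have hdegq : 0 < q.degree := natDegree_pos_iff_degree_pos.1 (hnd ▸ hpos)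
  have hlcq : q.leadingCoeff ≤ 0 := by
    have h1 : (-X : ℝ[X]).natDegree ≠ 0 := by simp
    rw [hq, leadingCoeff_comp h1, leadingCoeff_neg, leadingCoeff_X, hodd.neg_one_pow]
    linarith
  have hbot : Tendsto (fun x ↦ q.eval x) atTop atBot := q.tendsto_atBot_of_leadingCoeff_nonpos hdegq hlcq
  obtain ⟨a, ha⟩ := (htop.eventually (eventually_gt_atTop 0)).exists
  obtain ⟨b, hb⟩ := (hbot.eventually (eventually_lt_atBot 0)).exists
  have hb' : p.eval (-b) < 0 := by rwa [hqe] at hb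
  have hivt := intermediate_value_uIcc (a := -b) (b := a) (f := fun t ↦ p.eval t) p.continuousOn
  have h0 : (0 : ℝ) ∈ uIcc (p.eval (-b)) (p.eval a) := by
    rw [mem_uIcc]; left; exact ⟨hb'.le, ha.le⟩
  obtain ⟨z, -, hz⟩ := hivt h0
  exact ⟨z, hz⟩

/-! ### Input 2: first-order strict local minimum -/

/-- `p′(c) = 0 < p″(c)` ⟹ `c` is a STRICT local minimum: `p(c) < p(y)` for all `y ≠ c` with `|y − c| < δ`.
[folklore] -/
theorem exists_ball_lt_of_deriv2_pos {p : ℝ[X]} {c : ℝ} (hc : (derivative p).eval c = 0)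
    (h2 : 0 < (derivative (derivative p)).eval c) :
    ∃ δ > 0, ∀ y, y ≠ c → |y - c| < δ → p.eval c < p.eval y := by
  have hcont : ContinuousAt (fun x ↦ (derivative (derivative p)).eval x) c :=
    (derivative (derivative p)).continuous.continuousAt
  obtain ⟨δ, hδ, hball⟩ := Metric.mem_nhds_iff.1 (hcont.preimage_mem_nhds (Ioi_mem_nhds h2))
  have hpos : ∀ y, |y - c| < δ → 0 < (derivative (derivative p)).eval y := fun y hy ↦
    hball (by rwa [Metric.mem_ball, Real.dist_eq])
  refine ⟨δ, hδ, fun y hyc hy ↦ ?_⟩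
  have hmono : StrictMonoOn (fun x ↦ (derivative p).eval x) (Ioo (c - δ) (c + δ)) := by
    refine strictMonoOn_of_deriv_pos (convex_Ioo _ _) (derivative p).continuousOn fun x hx ↦ ?_
    rw [interior_Ioo] at hx
    rw [Polynomial.deriv]
    exact hpos x (by rw [abs_lt]; constructor <;> linarith [hx.1, hx.2])
  have hcI : c ∈ Ioo (c - δ) (c + δ) := ⟨by linarith, by linarith⟩
  rw [abs_lt] at hy
  rcases lt_or_gt_of_ne hyc with hlt | hgt
  · have hanti : StrictAntiOn (fun x ↦ p.eval x) (Icc y c) := by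
      refine strictAntiOn_of_deriv_neg (convex_Icc _ _) p.continuousOn fun t ht ↦ ?_
      rw [interior_Icc] at ht
      rw [Polynomial.deriv]
      have := hmono ⟨by linarith [ht.1], by linarith [ht.2]⟩ hcI ht.2
      simpa [hc] using this
    exact hanti ⟨le_refl _, hlt.le⟩ ⟨hlt.le, le_refl _⟩ hlt
  · have hmono' : StrictMonoOn (fun x ↦ p.eval x) (Icc c y) := by
      refine strictMonoOn_of_deriv_pos (convex_Icc _ _) p.continuousOn fun t ht ↦ ?_
      rw [interior_Icc] at ht
      rw [Polynomial.deriv]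
      have := hmono hcI ⟨by linarith [ht.1], by linarith [ht.2]⟩ ht.1
      simpa [hc] using this
    exact hmono' ⟨le_refl _, hgt.le⟩ ⟨hgt.le, le_refl _⟩ hgt


/-! ### Input 3: the enlarged interleaving at an interior strict local minimum -/

/-- If `p` (of positive degree) has a critical point `x₀` with `p(x₀) > 0` and `p″(x₀) > 0` (a strict local minimum
ABOVE the axis), then the distinct real roots `Z` of `p` and the off-root critical points `C₁ = C \ Z` satisfy
`#Z + 1 ≤ #C₁` — one better than Rolle. Proof: interleave `Z ∪ {x₀}` with `C` (Rolle between roots; IVT + Rolle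
between a root and `x₀`). [folklore] -/
theorem card_succ_le_of_localMin {p : ℝ[X]} (hp0 : p ≠ 0) (hp'0 : derivative p ≠ 0) {x₀ : ℝ}
    (hx₀ : (derivative p).eval x₀ = 0) (hpx₀ : 0 < p.eval x₀) (h2 : 0 < (derivative (derivative p)).eval x₀) :
    p.roots.toFinset.card + 1 ≤ ((derivative p).roots.toFinset \ p.roots.toFinset).card := by
  classical
  set Z : Finset ℝ := p.roots.toFinset with hZ
  set C : Finset ℝ := (derivative p).roots.toFinset with hC
  have memZ : ∀ x, x ∈ Z ↔ p.eval x = 0 := fun x ↦ by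
    rw [hZ, Multiset.mem_toFinset, mem_roots hp0, IsRoot]
  have memC : ∀ x, x ∈ C ↔ (derivative p).eval x = 0 := fun x ↦ by
    rw [hC, Multiset.mem_toFinset, mem_roots hp'0, IsRoot]
  have hx₀Z : x₀ ∉ Z := fun h ↦ hpx₀.ne' ((memZ x₀).1 h)
  have hx₀C : x₀ ∈ C := (memC x₀).2 hx₀
  obtain ⟨δ, hδ, hmin⟩ := exists_ball_lt_of_deriv2_pos hx₀ h2
  -- Rolle step: a critical point strictly between two points where `p` takes equal values
  have rolle : ∀ u v : ℝ, u < v → p.eval u = p.eval v → ∃ c ∈ C, u < c ∧ c < v := by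
    intro u v huv he
    obtain ⟨c, hc, hc0⟩ := exists_deriv_eq_zero (f := fun t ↦ p.eval t) huv p.continuousOn he
    exact ⟨c, (memC c).2 (by rwa [Polynomial.deriv] at hc0), hc.1, hc.2⟩
  set Z' : Finset ℝ := insert x₀ Z with hZ'
  have key : Z'.card ≤ (C \ Z').card + 1 := by
    refine Finset.card_le_sdiff_of_interleaved fun x hx y hy hxy _hgap ↦ ?_
    rw [hZ', Finset.mem_insert] at hx hy
    rcases hx with rfl | hxZ
    · -- x = x₀ < y, y a root: climb from the strict minimum, come back down to the value p(x₀), then Rolle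
      rcases hy with rfl | hyZ
      · exact absurd hxy (lt_irrefl _)
      · have hy0 : p.eval y = 0 := (memZ y).1 hyZ
        have hm1 := min_le_left δ (y - x)
        have hm2 := min_le_right δ (y - x)
        have hm3 : 0 < min δ (y - x) := lt_min hδ (by linarith)
        set y₁ : ℝ := x + min δ (y - x) / 2 with hy₁
        have h1 : x < y₁ := by rw [hy₁]; linarith
        have h1' : y₁ < y := by rw [hy₁]; linarith
        have hpy₁ : p.eval x < p.eval y₁ :=
          hmin y₁ (ne_of_gt h1) (by rw [hy₁, abs_lt]; constructor <;> linarith)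
        obtain ⟨y₂, hy₂, hpy₂⟩ : ∃ y₂ ∈ Ioo y₁ y, p.eval y₂ = p.eval x :=
          intermediate_value_Ioo' h1'.le p.continuousOn ⟨by rw [hy0]; exact hpx₀, hpy₁⟩
        obtain ⟨c, hcC, hxc, hcy⟩ := rolle x y₂ (h1.trans hy₂.1) hpy₂.symm
        exact ⟨c, hcC, hxc, hcy.trans hy₂.2⟩
    · rcases hy with rfl | hyZ
      · -- x a root < y = x₀: mirror image
        have hx0 : p.eval x = 0 := (memZ x).1 hxZ
        have hm1 := min_le_left δ (y - x)
        have hm2 := min_le_right δ (y - x)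
        have hm3 : 0 < min δ (y - x) := lt_min hδ (by linarith)
        set y₁ : ℝ := y - min δ (y - x) / 2 with hy₁
        have h1 : y₁ < y := by rw [hy₁]; linarith
        have h1' : x < y₁ := by rw [hy₁]; linarith
        have hpy₁ : p.eval y < p.eval y₁ :=
          hmin y₁ (ne_of_lt h1) (by rw [hy₁, abs_lt]; constructor <;> linarith)
        obtain ⟨y₂, hy₂, hpy₂⟩ : ∃ y₂ ∈ Ioo x y₁, p.eval y₂ = p.eval y :=
          intermediate_value_Ioo h1'.le p.continuousOn ⟨by rw [hx0]; exact hpx₀, hpy₁⟩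
        obtain ⟨c, hcC, hyc, hcy⟩ := rolle y₂ y (hy₂.2.trans h1) hpy₂
        exact ⟨c, hcC, hy₂.1.trans hyc, hcy⟩
      · -- two roots: Rolle
        exact rolle x y hxy (by rw [(memZ x).1 hxZ, (memZ y).1 hyZ])
  have hZ'card : Z'.card = Z.card + 1 := by rw [hZ', Finset.card_insert_of_notMem hx₀Z]
  have hCZ' : (C \ Z').card + 1 = (C \ Z).card := by
    have hmem : x₀ ∈ C \ Z := Finset.mem_sdiff.2 ⟨hx₀C, hx₀Z⟩
    have hpos : 0 < (C \ Z).card := Finset.card_pos.2 ⟨x₀, hmem⟩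
    rw [hZ', Finset.sdiff_insert, Finset.card_erase_of_mem hmem]
    omega
  omega

end Summit.RiemannHypothesis.RiemannHypothesis.Theorems.Splittings.JensenSignLawCount
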